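import Summits.CriticalPhenomena.PercolationContinuityZ3.Theorems.PercExchangeRateTransportTransportLemmaFence

/-!
# One-sided transport for the crux `SubcritExchangeUniformity` (K⁻, stmt-CriticalPhenomena-16062), line `onesided`:
# Heine–Cantor on the RIGHT closed collar (`rightCollar_moduli`)

A bound and a uniform modulus for a field `a` continuous on the right closed collar
`{(p,t) : t ∈ [lo,hi], pc t ≤ p ≤ pc t + ρ}` (a continuous image of the compact rectangle `[lo,hi] × [0,ρ]`).
Percolation-free; Mathlib only. Helper stub `rightCollar_moduli` registered on stmt-CriticalPhenomena-16062 (lead c1).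
-/

namespace Summit.CriticalPhenomena.PercolationContinuityZ3.Theorems.SubcritExchangeUniformity.TransportMono

open Filter Topology Set

/-- **Heine–Cantor on the right closed collar**: a bound `A` and, for every `η > 0`, a uniform modulus `ω` for `a` on
`{(p,t) : t ∈ [lo,hi], pc t ≤ p ≤ pc t + ρ}`. -/
theorem rightCollar_moduli : ∀ (pc : ℝ → ℝ) (a : ℝ → ℝ → ℝ) (lo hi ρ : ℝ), 0 ≤ ρ → ContinuousOn pc (Set.Icc lo hi) → ContinuousOn (fun x : ℝ × ℝ => a x.1 x.2) {x : ℝ × ℝ | x.2 ∈ Set.Icc lo hi ∧ pc x.2 ≤ x.1 ∧ x.1 ≤ pc x.2 + ρ} → (∃ A : ℝ, ∀ t ∈ Set.Icc lo hi, ∀ p : ℝ, pc t ≤ p → p ≤ pc t + ρ → |a p t| ≤ A) ∧ (∀ η > (0 : ℝ), ∃ ω > (0 : ℝ), ∀ t ∈ Set.Icc lo hi, ∀ t' ∈ Set.Icc lo hi, ∀ p p' : ℝ, pc t ≤ p → p ≤ pc t + ρ → pc t' ≤ p' → p' ≤ pc t' + ρ → |t - t'| ≤ ω → |p - p'| ≤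 ω → |a p t - a p' t'| ≤ η) := by
  intro pc a lo hi ρ _hρ hpc ha
  -- adapted from `collar_moduli` (PercExchangeRateTransportTransportLemmaFence): right collar = φ '' ([lo,hi] ×ˢ [0,ρ]).
  set C : Set (ℝ × ℝ) := {x : ℝ × ℝ | x.2 ∈ Icc lo hi ∧ pc x.2 ≤ x.1 ∧ x.1 ≤ pc x.2 + ρ} with hC
  set K : Set (ℝ × ℝ) := Icc lo hi ×ˢ Icc 0 ρ with hK
  set φ : ℝ × ℝ → ℝ × ℝ := fun y => (pc y.1 + y.2, y.1) with hφ
  have hKc : IsCompact K := isCompact_Icc.prod isCompact_Icc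
  have hφc : ContinuousOn φ K := by
    have h1 : ContinuousOn (fun y : ℝ × ℝ => pc y.1) K :=
      hpc.comp continuous_fst.continuousOn (fun y hy => hy.1)
    exact ((h1.add continuous_snd.continuousOn).prodMk continuous_fst.continuousOn)
  have hCK : C = φ '' K := by
    ext x
    constructor
    · rintro ⟨hx2, hx1, hx1'⟩
      refine ⟨(x.2, x.1 - pc x.2), ⟨hx2, ?_⟩, ?_⟩
      · exact ⟨by linarith, by linarith⟩
      · simp only [hφ]; ext <;> simp
    · rintro ⟨y, ⟨hy1, hy2⟩, rfl⟩
      refine ⟨hy1, ?_, ?_⟩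
      · show pc y.1 ≤ pc y.1 + y.2
        linarith [hy2.1]
      · show pc y.1 + y.2 ≤ pc y.1 + ρ
        linarith [hy2.2]
  have hCc : IsCompact C := by rw [hCK]; exact hKc.image_of_continuousOn hφc
  constructor
  · obtain ⟨A, hA⟩ := hCc.exists_bound_of_continuousOn ha
    refine ⟨A, fun t ht p hp hp' => ?_⟩
    have := hA (p, t) ⟨ht, hp, hp'⟩
    simpa [Real.norm_eq_abs] using this
  · intro η hη
    have hu := hCc.uniformContinuousOn_of_continuous ha
    rw [Metric.uniformContinuousOn_iff_le] at hu
    obtain ⟨ω, hω, h⟩ := hu η hη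
    refine ⟨ω, hω, fun t ht t' ht' p p' hp hpρ hp' hp'ρ htt hpp => ?_⟩
    have hd : dist ((p, t) : ℝ × ℝ) (p', t') ≤ ω := by
      rw [Prod.dist_eq, Real.dist_eq, Real.dist_eq]
      exact max_le hpp htt
    have := h (p, t) ⟨ht, hp, hpρ⟩ (p', t') ⟨ht', hp', hp'ρ⟩ hd
    rwa [Real.dist_eq] at this

end Summit.CriticalPhenomena.PercolationContinuityZ3.Theorems.SubcritExchangeUniformity.TransportMono
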